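/-
Copyright (c) 2026 the pub-hodgecm-mathlib formalisation cell (harness21).  Prover seat hodgecm-mathlib-A-p19 (g20), D-T road (Tamagawa ∕ (K7-s)),
brick B1″ «D-T3′-def, uniqueness and congruence transport» (LEAD F0P3a-plan (g9) WORD T8-1 (B), 2026-09-01).
-/
import Literature.NumberTheory.Weil1964.UnitaryArchTopFormHaarCM
import Literature.NumberTheory.Automorphic.UnitaryGroupFormTransport
import HarnessLib

/-!
# The top-form Haar measure of `U(J)(E ⊗ ℝ)` is characterised by its Cayley germ — window independence and uniqueness
# (Helgason 2000 Ch. I §1 Thm. 1.14; Rogawski 1990 §1.7 «compatible measures»)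

Topic `NumberTheory/Weil1964`; namespace `Literature.NumberTheory.Weil1964.UnitaryArchTopForm`.  THEOREMS ONLY (no definition, no instance, no notation, no named fact, no
`sorry`).  Cell `pub/hodgecm-mathlib`, crux H413 = `stmt-HodgeConjecture-24833`; D-T road row «D-T3′», brick B1″ over ★ B1 `UnitaryArchTopFormHaar` and ★ B1′ `…HaarCM`
(census `CENSUS-B2-ArchSingularCentralizerTopFormHaar` 2aaa130ebe3bf25a §4: frame independence of the centraliser measure reduces to the transport of `archTopFormHaar` under a
form congruence, which in turn is ONE uniqueness lemma: a Haar measure whose restriction to SOME Cayley window `ĉ(V)` is the chart measure `ĉ_*(w₀ · lieStdLebesgue|_V)` IS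
`archTopFormHaar J` — the window of record plays no role).
* §1 `cayleyChartMeasure_image_inter` (the chart measure of `ĉ(V ∩ V′)` for windows inside the source, via ★ `injOn_cayleyChart`),
  **`eq_archTopFormHaar_of_restrict_eq`** (UNIQUENESS ∕ WINDOW INDEPENDENCE: Haar + the window identity on any window ⇒ `= archTopFormHaar J`; Mathlib `isMulLeftInvariant_eq_smul`
  + evaluation on `ĉ(V ∩ V₀)`).
* §2 congruence algebra for `T ∈ GL_N(E ⊗ ℝ)` with `σ(T)ᵀ J′ T = J₂′` (★ `formCongr`): `archStar_inv_mul_archStar`, **`conj_mem_archSkew`** (`X ∈ 𝔲(J₂) ⇒ T X T⁻¹ ∈ 𝔲(J)`),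
  **`traceForm_conj`** (`β(TXT⁻¹, TYT⁻¹) = β(X, Y)`), **`cayley_conj`** (`c(TXT⁻¹) = T c(X) T⁻¹`).  The measure-transport theorem itself
  (`map (unitaryGroupOfFormCongrOfEq …) (archTopFormHaar J₂) = archTopFormHaar J`, from §1 + §2 + `LinearMap.det_conj` + `Module.Basis.map_addHaar`) is the sequel file.
HONEST SCOPE.  Measure theory over ★ B1∕B1′∕B5b and Mathlib's uniqueness of Haar measure.  HC_CM is proved only modulo the printed citations until rung 0 closes; this file
discharges no printed statement.

## References
* S. Helgason, *Groups and Geometric Analysis*, AMS Math. Surveys Monogr. 83 (2000), Ch. I §1 Thm. 1.14 p. 96. [Helgason2000]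
* J. D. Rogawski, *Automorphic Representations of Unitary Groups in Three Variables*, Ann. of Math. Stud. 123 (1990), §1.7 p. 6. [Rogawski1990]
-/

set_option autoImplicit false
-- the scoped normed structure on the submodule `𝔲 ≤ M_N(E ⊗ ℝ)` vs the `[BorelSpace ↥(archSkew …)]` binder's subtype topology (as in ★ B1 ∕ ★ B5b)
set_option backward.isDefEq.respectTransparency false

noncomputable section

open NumberField NumberField.mixedEmbedding NumberField.InfinitePlace Set Filter Topology MeasureTheory MeasureTheory.Measure
open Literature.NumberTheory.Automorphic Literature.NumberTheory.Automorphic.UnitaryGroup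
open scoped Classical Matrix Matrix.Norms.Operator MatrixGroups ENNReal NNReal Pointwise

namespace Literature.NumberTheory.Weil1964

namespace UnitaryArchTopForm

section Uniqueness

variable (F E : Type) [Field F] [Field E] [NumberField E] [Algebra F E] (c : E ≃ₐ[F] E) (N : ℕ) (J : Matrix (Fin N) (Fin N) E)

variable {F E c N}

variable [MeasurableSpace (archSkew F E c N J)] [BorelSpace (archSkew F E c N J)] [MeasurableSpace (arch F E c N J)] [BorelSpace (arch F E c N J)]

/-- **The chart measure of a sub-window image**: for `V, V′ ⊆ source`, `ν_V(ĉ(V ∩ V′)) = ∫_{V ∩ V′} w₀ dλ` — the chart is injective on its source (★ `injOn_cayleyChart`).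
[cite: Helgason2000, Ch. I §1 Thm. 1.14 p. 96] -/
theorem cayleyChartMeasure_image_inter (lam : Measure (archSkew F E c N J)) {V V' : Set (archSkew F E c N J)}
    (hVs : V ⊆ cayleySource F E c N J) (hVo : IsOpen V) (hV'o : IsOpen V') :
    cayleyChartMeasure F E c N J lam V (cayleyChart F E c N J '' (V ∩ V')) =
      ∫⁻ X in V ∩ V', ENNReal.ofReal (cayleyWeight F E c N J X) ∂lam := by
  have hpre : cayleyChart F E c N J ⁻¹' (cayleyChart F E c N J '' (V ∩ V')) ∩ V = V ∩ V' := by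
    ext X
    constructor
    · rintro ⟨⟨Y, hY, hYX⟩, hXV⟩
      have : Y = X := injOn_cayleyChart J (hVs hY.1) (hVs hXV) hYX
      subst this
      exact hY
    · intro hX
      exact ⟨⟨X, hX, rfl⟩, hX.1⟩
  rw [cayleyChartMeasure_apply J lam V (isOpen_image_cayleyChart J (fun X hX => hVs hX.1) (hVo.inter hV'o)).measurableSet, hpre]

/-- **UNIQUENESS ∕ WINDOW INDEPENDENCE**: a Haar measure `μ` on `U(J)(E ⊗ ℝ)` whose restriction to SOME Cayley window `ĉ(V)` (`V` open, `0 ∈ V ⊆ source`) is the chart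
measure `ĉ_*(w₀ · lieStdLebesgue J|_V)` IS `archTopFormHaar J` (Haar uniqueness `μ = s • archTopFormHaar`, and `s = 1` by evaluating both on `ĉ(V ∩ V₀)`).
[cite: Helgason2000, Ch. I §1 Thm. 1.14 p. 96] [cite: Rogawski1990, §1.7 p. 6] -/
theorem eq_archTopFormHaar_of_restrict_eq (hnd : lieGramDet F E c N J ≠ 0) (μ : Measure (arch F E c N J)) [μ.IsHaarMeasure]
    {V : Set (archSkew F E c N J)} (hVo : IsOpen V) (h0 : (0 : archSkew F E c N J) ∈ V) (hVs : V ⊆ cayleySource F E c N J)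
    (hμ : μ.restrict (cayleyChart F E c N J '' V) = cayleyChartMeasure F E c N J (lieStdLebesgue F E c N J) V) :
    μ = archTopFormHaar F E c N J := by
  haveI := isHaarMeasure_archTopFormHaar J hnd
  haveI := isAddHaarMeasure_lieStdLebesgue J hnd
  set ν := archTopFormHaar F E c N J with hν
  -- Haar uniqueness
  have hs := isMulLeftInvariant_eq_smul μ ν
  set s := haarScalarFactor μ ν with hsdef
  -- the common sub-window `ĉ(V ∩ V₀)`
  set W' := cayleyChart F E c N J '' (V ∩ window F E c N J) with hW'
  have hW'o : IsOpen W' := isOpen_image_cayleyChart J (fun X hX => hVs hX.1) (hVo.inter (isOpen_window J))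
  have hW'ne : W'.Nonempty := ⟨_, ⟨0, ⟨h0, zero_mem_window J⟩, rfl⟩⟩
  have hνW'0 : ν W' ≠ 0 := (hW'o.measure_pos ν hW'ne).ne'
  have hνW'top : ν W' ≠ ⊤ :=
    ((measure_mono ((Set.image_mono Set.inter_subset_right).trans subset_closure)).trans_lt (isCompact_closure_image_window J).measure_lt_top).ne
  -- both measures give `W'` the mass `∫_{V ∩ V₀} w₀ dλ`
  have hμW' : μ W' = ∫⁻ X in V ∩ window F E c N J, ENNReal.ofReal (cayleyWeight F E c N J X) ∂(lieStdLebesgue F E c N J) := by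
    have hsub : W' ⊆ cayleyChart F E c N J '' V := Set.image_mono Set.inter_subset_left
    have h1 : μ W' = (μ.restrict (cayleyChart F E c N J '' V)) W' := by
      rw [Measure.restrict_apply' (isOpen_image_cayleyChart J hVs hVo).measurableSet, Set.inter_eq_left.2 hsub]
    rw [h1, hμ]
    exact cayleyChartMeasure_image_inter J _ hVs hVo (isOpen_window J)
  have hνW' : ν W' = ∫⁻ X in V ∩ window F E c N J, ENNReal.ofReal (cayleyWeight F E c N J X) ∂(lieStdLebesgue F E c N J) := by
    have hsub : W' ⊆ cayleyChart F E c N J '' window F E c N J := Set.image_mono Set.inter_subset_right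
    have h1 : ν W' = (ν.restrict (cayleyChart F E c N J '' window F E c N J)) W' := by
      rw [Measure.restrict_apply' (isOpen_image_window J).measurableSet, Set.inter_eq_left.2 hsub]
    rw [h1, hν, archTopFormHaar_restrict_window J hnd, hW', Set.inter_comm]
    exact cayleyChartMeasure_image_inter J _ (window_subset_cayleySource J) (isOpen_window J) hVo
  -- hence `s = 1`
  have hsμ : μ W' = (s : ℝ≥0∞) * ν W' := by
    have := congrArg (fun m : Measure (arch F E c N J) => m W') hs
    simpa only [Measure.coe_nnreal_smul_apply] using this
  have hs1 : (s : ℝ≥0∞) = 1 := by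
    rw [← ENNReal.mul_left_inj hνW'0 hνW'top, one_mul, ← hsμ, hμW', hνW']
  rw [hs, show s = 1 from by exact_mod_cast hs1, one_smul]

end Uniqueness

/-! ## §2 Congruence algebra: `X ↦ T X T⁻¹` carries `𝔲(σ(T)ᵀ J′ T)` onto `𝔲(J′)`, preserving the trace form, the Cayley chart and the Cayley weight -/

section Congruence

variable (F E : Type) [Field F] [Field E] [NumberField E] [Algebra F E] (c : E ≃ₐ[F] E) (N : ℕ) (J J₂ : Matrix (Fin N) (Fin N) E)

variable {F E c N J J₂}

omit [NumberField E] in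
/-- `σ(T⁻¹)ᵀ σ(T)ᵀ = 1` in the `archStar` spelling. [cite: Knapp2002, I §1] -/
theorem archStar_inv_mul_archStar (T : GL (Fin N) (mixedSpace E)) :
    archStar F E c N ((T⁻¹ : GL (Fin N) (mixedSpace E)) : Matrix (Fin N) (Fin N) (mixedSpace E)) * archStar F E c N (T : Matrix (Fin N) (Fin N) (mixedSpace E)) = 1 := by
  rw [← archStar_mul, ← Units.val_mul, mul_inv_cancel, Units.val_one, archStar_one]

omit [NumberField E] in
/-- **Conjugation carries the Lie algebras**: if `σ(T)ᵀ J′ T = J₂′` (`J′ = archFormOf J`, `J₂′ = archFormOf J₂`) and `X ∈ 𝔲(J₂)` then `T X T⁻¹ ∈ 𝔲(J)`.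
[cite: Knapp2002, I §1] [cite: Rogawski1990, §1.7 p. 6] -/
theorem conj_mem_archSkew {T : GL (Fin N) (mixedSpace E)} (h : formCongr (conjMixed F E c) T (archFormOf E N J) = archFormOf E N J₂)
    {X : Matrix (Fin N) (Fin N) (mixedSpace E)} (hX : X ∈ archSkew F E c N J₂) :
    (T : Matrix (Fin N) (Fin N) (mixedSpace E)) * X * ((T⁻¹ : GL (Fin N) (mixedSpace E)) : Matrix (Fin N) (Fin N) (mixedSpace E)) ∈ archSkew F E c N J := by
  rw [mem_archSkew_iff] at hX ⊢
  set Tm : Matrix (Fin N) (Fin N) (mixedSpace E) := (T : Matrix (Fin N) (Fin N) (mixedSpace E)) with hTm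
  set Ti : Matrix (Fin N) (Fin N) (mixedSpace E) := ((T⁻¹ : GL (Fin N) (mixedSpace E)) : Matrix (Fin N) (Fin N) (mixedSpace E)) with hTi
  have hTT : Tm * Ti = 1 := by rw [hTm, hTi, ← Units.val_mul, mul_inv_cancel, Units.val_one]
  have hSS : archStar F E c N Ti * archStar F E c N Tm = 1 := archStar_inv_mul_archStar T
  have hJ₂ : archFormOf E N J₂ = archStar F E c N Tm * archFormOf E N J * Tm := by rw [← h]; rfl
  rw [hJ₂] at hX
  -- multiply `hX` by `archStar Ti` on the left and `Ti` on the right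
  have key := congrArg (fun A => archStar F E c N Ti * A * Ti) hX
  simp only [mul_add, add_mul, Matrix.mul_zero, Matrix.zero_mul] at key
  rw [archStar_mul, archStar_mul]
  have e1 : archStar F E c N Ti * (archStar F E c N X * (archStar F E c N Tm * archFormOf E N J * Tm)) * Ti =
      archStar F E c N Ti * archStar F E c N X * archStar F E c N Tm * archFormOf E N J := by
    simp only [Matrix.mul_assoc, hTT, Matrix.mul_one]
  have e2 : archStar F E c N Ti * (archStar F E c N Tm * archFormOf E N J * Tm * X) * Ti = archFormOf E N J * (Tm * X * Ti) := by
    rw [show archStar F E c N Ti * (archStar F E c N Tm * archFormOf E N J * Tm * X) * Ti =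
        (archStar F E c N Ti * archStar F E c N Tm) * (archFormOf E N J * (Tm * X * Ti)) by simp only [Matrix.mul_assoc], hSS, Matrix.one_mul]
  rw [e1, e2] at key
  simpa only [Matrix.mul_assoc] using key

/-- **The trace form is conjugation-invariant**: `β(T X T⁻¹, T Y T⁻¹) = β(X, Y)`. [cite: Macdonald1980, p. 93] -/
theorem traceForm_conj (T : GL (Fin N) (mixedSpace E)) (X Y : Matrix (Fin N) (Fin N) (mixedSpace E)) :
    traceForm E N ((T : Matrix (Fin N) (Fin N) (mixedSpace E)) * X * ((T⁻¹ : GL (Fin N) (mixedSpace E)) : Matrix (Fin N) (Fin N) (mixedSpace E)))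
        ((T : Matrix (Fin N) (Fin N) (mixedSpace E)) * Y * ((T⁻¹ : GL (Fin N) (mixedSpace E)) : Matrix (Fin N) (Fin N) (mixedSpace E))) =
      traceForm E N X Y := by
  have hTT : ((T⁻¹ : GL (Fin N) (mixedSpace E)) : Matrix (Fin N) (Fin N) (mixedSpace E)) * (T : Matrix (Fin N) (Fin N) (mixedSpace E)) = 1 := by
    rw [← Units.val_mul, inv_mul_cancel, Units.val_one]
  set Tm : Matrix (Fin N) (Fin N) (mixedSpace E) := (T : Matrix (Fin N) (Fin N) (mixedSpace E)) with hTm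
  set Ti : Matrix (Fin N) (Fin N) (mixedSpace E) := ((T⁻¹ : GL (Fin N) (mixedSpace E)) : Matrix (Fin N) (Fin N) (mixedSpace E)) with hTi
  have hprod : Tm * X * Ti * (Tm * Y * Ti) = Tm * (X * Y) * Ti := by
    simp only [Matrix.mul_assoc]
    rw [← Matrix.mul_assoc Ti Tm (Y * Ti), hTT, Matrix.one_mul]
  rw [traceForm_apply, traceForm_apply, hprod, Matrix.trace_mul_cycle, hTT, Matrix.one_mul]

omit [NumberField E] in
/-- **The Cayley transform is conjugation-equivariant**: `c(T X T⁻¹) = T c(X) T⁻¹` (for `1 + X` a unit). [cite: Weyl1939, Ch. II §10] -/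
theorem cayley_conj (T : GL (Fin N) (mixedSpace E)) {X : Matrix (Fin N) (Fin N) (mixedSpace E)} (hX : IsUnit (1 + X)) :
    Literature.Analysis.Calculus.cayley ((T : Matrix (Fin N) (Fin N) (mixedSpace E)) * X * ((T⁻¹ : GL (Fin N) (mixedSpace E)) : Matrix (Fin N) (Fin N) (mixedSpace E))) =
      (T : Matrix (Fin N) (Fin N) (mixedSpace E)) * Literature.Analysis.Calculus.cayley X * ((T⁻¹ : GL (Fin N) (mixedSpace E)) : Matrix (Fin N) (Fin N) (mixedSpace E)) := by
  obtain ⟨u, hu⟩ := hX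
  set Tm : Matrix (Fin N) (Fin N) (mixedSpace E) := (T : Matrix (Fin N) (Fin N) (mixedSpace E)) with hTm
  set Ti : Matrix (Fin N) (Fin N) (mixedSpace E) := ((T⁻¹ : GL (Fin N) (mixedSpace E)) : Matrix (Fin N) (Fin N) (mixedSpace E)) with hTi
  have hTT : Tm * Ti = 1 := by rw [hTm, hTi, ← Units.val_mul, mul_inv_cancel, Units.val_one]
  have h1 : 1 + Tm * X * Ti = ((T * u * T⁻¹ : (Matrix (Fin N) (Fin N) (mixedSpace E))ˣ) : Matrix (Fin N) (Fin N) (mixedSpace E)) := by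
    rw [Units.val_mul, Units.val_mul, hu, ← hTm, ← hTi, Matrix.mul_add, Matrix.add_mul, Matrix.mul_one, hTT]
  have h2 : 1 - Tm * X * Ti = Tm * (1 - X) * Ti := by rw [Matrix.mul_sub, Matrix.sub_mul, Matrix.mul_one, hTT]
  rw [Literature.Analysis.Calculus.cayley_def, Literature.Analysis.Calculus.cayley_def, h1, Ring.inverse_unit, h2, ← hu, Ring.inverse_unit,
    mul_inv_rev, mul_inv_rev, inv_inv, Units.val_mul, Units.val_mul, ← hTm, ← hTi]
  simp only [Matrix.mul_assoc]
  rw [← Matrix.mul_assoc Ti Tm, show Ti * Tm = 1 by rw [hTm, hTi, ← Units.val_mul, inv_mul_cancel, Units.val_one], Matrix.one_mul]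

end Congruence


end UnitaryArchTopForm

end Literature.NumberTheory.Weil1964

end
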